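import Summits.PneNP.GCT.Certificates.MaxDet4D10L17_8_3_2_2_2_2_2_2BEval1
import HarnessLib

/-!
# Kernel certificate family (det₄ side, cell `pub-gct-max`, pair 17 generator B): `4 ≤ mult_{λ*} ℂ[Δ(det₄)]_10`, `λ = (17,8,3,2⁶)` — EVAL sibling 2 of 2 (kernel `decide` nodes of the split planner for entry chain (single-decide entries); 4 declarations)

Imports its predecessor sibling `MaxDet4D10L17_8_3_2_2_2_2_2_2BEval1` (V2: single chain).
Sibling of the multi-file certificate `MaxDet4D10L17_8_3_2_2_2_2_2_2B` (main file; statements about multiplicities live THERE). Layout =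
generator B design note CERT-DESIGN-B-MULTIFILE.md as accepted by `val-gct-ref-3` (DESIGN-OK-CONDITIONAL V1–V8): Data →
Eval1 → … → EvalK → main, a single import chain; every kernel node keeps the single-file shape (`layersB … = L` /
`layerSumB (layersB …) = s`, each ONE `decide +kernel` of ≤ 4 000 walk outcomes); declarations of earlier siblings are
used by name. Split across files only to respect the 400-line / 200 000-byte limits on `Summits/` files.
HONEST FRAMING: a kernel-checked LOWER bound at small parameters on a row the cell booked det-FULL (census word) —
negative census at the KNOWN separation `(3,4)` (`dc̄(per₃) ≥ 5`), method validation; nothing `(3,5)`; no claim about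
VP ≠ VNP or P ≠ NP. Row `det=4, d=10, λ = (17,8,3,2⁶)`, booked `r_Ω = a = 4` (job j237784); generator B = `val-gct-eng-34` gen/ `4b41805eac0c`.
[folklore] bookkeeping.
-/

namespace Summit.PneNP.GCT

open Literature.Computability.AlgebraicComplexity Literature.Computability.AlgebraicComplexity.TableauEval
open _root_.Literature.NumberTheory.DiophantineGeometry

/-! ## §2 Kernel evaluations — segment 2 of 2 -/

/-- **Kernel computation (3,0)**: functional #3 at det₄-point #0 evaluates to `11148` modulo `65537`
(exact value `-730595328`; one `decide +kernel` of `evalB`; layer sizes 1/6/24/174/84/167/180/117/49/30, 3502 walk outcomes, 167 trie leaves).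
[folklore] -/
theorem certB_10_17_8_3_2_2_2_2_2_2_evalB_3_0 :
    evalB (certB_10_17_8_3_2_2_2_2_2_2.pointModDet 65537 0) certB_10_17_8_3_2_2_2_2_2_2_net3 = (11148 : ZMod 65537) := by
  set_option maxHeartbeats 0 in decide +kernel

/-- **Kernel computation (3,1)**: functional #3 at det₄-point #1 evaluates to `81` modulo `65537`
(exact value `-5308416`; one `decide +kernel` of `evalB`; layer sizes 1/7/14/102/26/111/193/168/72/43, 2936 walk outcomes, 153 trie leaves).
[folklore] -/
theorem certB_10_17_8_3_2_2_2_2_2_2_evalB_3_1 :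
    evalB (certB_10_17_8_3_2_2_2_2_2_2.pointModDet 65537 1) certB_10_17_8_3_2_2_2_2_2_2_net3 = (81 : ZMod 65537) := by
  set_option maxHeartbeats 0 in decide +kernel

/-- **Kernel computation (3,2)**: functional #3 at det₄-point #2 evaluates to `0` modulo `65537`
(exact value `0`; one `decide +kernel` of `evalB`; layer sizes 1/7/14/100/14/69/137/136/67/39, 2243 walk outcomes, 351 trie leaves).
[folklore] -/
theorem certB_10_17_8_3_2_2_2_2_2_2_evalB_3_2 :
    evalB (certB_10_17_8_3_2_2_2_2_2_2.pointModDet 65537 2) certB_10_17_8_3_2_2_2_2_2_2_net3 = (0 : ZMod 65537) := by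
  set_option maxHeartbeats 0 in decide +kernel

/-- **Kernel computation (3,3)**: functional #3 at det₄-point #3 evaluates to `38143` modulo `65537`
(exact value `-6794772480`; one `decide +kernel` of `evalB`; layer sizes 1/5/15/94/64/124/140/97/42/22, 2356 walk outcomes, 227 trie leaves).
[folklore] -/
theorem certB_10_17_8_3_2_2_2_2_2_2_evalB_3_3 :
    evalB (certB_10_17_8_3_2_2_2_2_2_2.pointModDet 65537 3) certB_10_17_8_3_2_2_2_2_2_2_net3 = (38143 : ZMod 65537) := by
  set_option maxHeartbeats 0 in decide +kernel

end Summit.PneNP.GCT
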